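import Literature.MathematicalPhysics.QuantumLattice.LatticeScalarField

/-!
# A floor for lattice Riemann sums of a non-negative non-zero bump on `ℝ⁴` (route-independent support for
# `SqueezedSkewness.HighBallFloorsLPGlue`, stmt-QuantumFields-22797)

For a continuous `f ≥ 0` on `ℝ⁴` with compact support (`tsupport f ⊆ closedBall 0 R`) and `f ≠ 0`: there are `c₀ > 0`,
`a₀ > 0` with `c₀ ≤ a⁴ · Σ_{x ∈ ℤ⁴} f(a x)` for all `0 < a ≤ a₀` — `f ≥ m > 0` on a small cube, which contains `≥ (ℓ/2a)⁴`
points of `aℤ⁴`.  (The closer only needs this crude floor, not the Riemann-sum limit.)  No definitions. [folklore]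
-/

noncomputable section

open scoped BigOperators
open MeasureTheory Filter Topology Set Metric Finset
open Literature.MathematicalPhysics.QuantumLattice

namespace Summit.QuantumFields.YangMills.Theorems.SqueezedSkewnessLatticeSumFloor

/-- Integers `t` with `u ≤ a t ≤ u + ℓ`: at least `ℓ/a − 1` of them (`a > 0`). [folklore] -/
theorem card_Icc_ge (a u ℓ : ℝ) :
    ℓ / a - 1 ≤ ((Finset.Icc ⌈u / a⌉ ⌊(u + ℓ) / a⌋).card : ℝ) := by
  rw [Int.card_Icc]
  have h1 : (⌈u / a⌉ : ℝ) < u / a + 1 := Int.ceil_lt_add_one _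
  have h2 : ((u + ℓ) / a : ℝ) < ⌊(u + ℓ) / a⌋ + 1 := Int.lt_floor_add_one _
  have h3 : (u + ℓ) / a = u / a + ℓ / a := by rw [add_div]
  have hz : ((⌊(u + ℓ) / a⌋ + 1 - ⌈u / a⌉ : ℤ) : ℝ) ≤ (((⌊(u + ℓ) / a⌋ + 1 - ⌈u / a⌉).toNat : ℕ) : ℝ) := by
    exact_mod_cast Int.self_le_toNat _
  have : ℓ / a - 1 ≤ ((⌊(u + ℓ) / a⌋ + 1 - ⌈u / a⌉ : ℤ) : ℝ) := by push_cast; linarith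
  exact this.trans hz

/-- Membership in that integer interval puts `a t` in `[u, u + ℓ]`. [folklore] -/
theorem mem_Icc_bounds {a u ℓ : ℝ} (ha : 0 < a) {t : ℤ} (ht : t ∈ Finset.Icc ⌈u / a⌉ ⌊(u + ℓ) / a⌋) :
    u ≤ a * t ∧ a * t ≤ u + ℓ := by
  rw [Finset.mem_Icc] at ht
  obtain ⟨h1, h2⟩ := ht
  have h1' : u / a ≤ t := (Int.le_ceil _).trans (by exact_mod_cast h1)
  have h2' : (t : ℝ) ≤ (u + ℓ) / a := (show (t : ℝ) ≤ ⌊(u + ℓ) / a⌋ by exact_mod_cast h2).trans (Int.floor_le _)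
  constructor
  · rw [div_le_iff₀ ha] at h1'; linarith
  · rw [le_div_iff₀ ha] at h2'; linarith

/-- **LATTICE-SUM FLOOR.**  For a continuous `f ≥ 0` with `tsupport f ⊆ closedBall 0 R` and `f ≠ 0` there are `c₀, a₀ > 0`
with `c₀ ≤ a⁴ Σ_{x ∈ ℤ⁴} f(a x)` for `0 < a ≤ a₀`. [folklore] -/
theorem lattice_sum_floor {f : EuclideanSpace ℝ (Fin 4) → ℝ} (hf : Continuous f) (hf0 : ∀ y, 0 ≤ f y)
    {R : ℝ} (hfR : tsupport f ⊆ Metric.closedBall (0 : EuclideanSpace ℝ (Fin 4)) R) (hfne : f ≠ 0) :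
    ∃ c₀ a₀ : ℝ, 0 < c₀ ∧ 0 < a₀ ∧ ∀ a : ℝ, 0 < a → a ≤ a₀ →
      c₀ ≤ a ^ 4 * ∑' x : Fin 4 → ℤ, f (a • siteToE (d := 4) x) := by
  -- a point where `f > 0` and a cube around it where `f ≥ m`
  obtain ⟨y₀, hy₀⟩ : ∃ y₀, f y₀ ≠ 0 := by
    by_contra h
    push Not at h
    exact hfne (funext fun y => by simpa using h y)
  have hpos : 0 < f y₀ := lt_of_le_of_ne (hf0 y₀) (Ne.symm hy₀)
  set m : ℝ := f y₀ / 2 with hm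
  have hm0 : 0 < m := by positivity
  obtain ⟨r, hr, hball⟩ : ∃ r > 0, ∀ y, dist y y₀ < r → m ≤ f y := by
    have hc := (Metric.continuous_iff.mp hf) y₀ (f y₀ / 2) (by positivity)
    obtain ⟨r, hr, h⟩ := hc
    refine ⟨r, hr, fun y hy => ?_⟩
    have := h y hy
    rw [Real.dist_eq, abs_lt] at this
    rw [hm]; linarith [this.1]
  set ℓ : ℝ := r / 4 with hℓ
  have hℓ0 : 0 < ℓ := by positivity
  refine ⟨m * ℓ ^ 4 / 16, ℓ / 2, by positivity, by positivity, fun a ha haℓ => ?_⟩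
  -- the box of lattice points
  set B : Finset (Fin 4 → ℤ) := Fintype.piFinset fun i : Fin 4 => Finset.Icc ⌈y₀ i / a⌉ ⌊(y₀ i + ℓ) / a⌋ with hB
  have hBmem : ∀ x ∈ B, m ≤ f (a • siteToE (d := 4) x) := by
    intro x hx
    rw [hB, Fintype.mem_piFinset] at hx
    apply hball
    have hcoord : ∀ i : Fin 4, y₀ i ≤ a * (x i : ℝ) ∧ a * (x i : ℝ) ≤ y₀ i + ℓ := fun i => mem_Icc_bounds ha (hx i)
    rw [EuclideanSpace.dist_eq]
    have hsum : ∑ i : Fin 4, dist ((a • siteToE (d := 4) x) i) (y₀ i) ^ 2 ≤ ∑ i : Fin 4, ℓ ^ 2 := by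
      refine Finset.sum_le_sum fun i _ => ?_
      have hi : (a • siteToE (d := 4) x) i = a * (x i : ℝ) := by simp [siteToE_apply]
      rw [hi, Real.dist_eq]
      have h := hcoord i
      have habs : |a * (x i : ℝ) - y₀ i| ≤ ℓ := abs_le.mpr ⟨by linarith [h.1], by linarith [h.2]⟩
      nlinarith [abs_nonneg (a * (x i : ℝ) - y₀ i)]
    have h4 : ∑ i : Fin 4, ℓ ^ 2 = 4 * ℓ ^ 2 := by simp [Finset.sum_const]
    calc Real.sqrt (∑ i : Fin 4, dist ((a • siteToE (d := 4) x) i) (y₀ i) ^ 2) ≤ Real.sqrt (4 * ℓ ^ 2) :=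
          Real.sqrt_le_sqrt (hsum.trans h4.le)
      _ = 2 * ℓ := by
          rw [show (4 : ℝ) * ℓ ^ 2 = (2 * ℓ) ^ 2 by ring, Real.sqrt_sq (by positivity)]
      _ < r := by rw [hℓ]; linarith
  -- its cardinality
  have hBcard : (ℓ / (2 * a)) ^ 4 ≤ (B.card : ℝ) := by
    rw [hB, Fintype.card_piFinset]
    push_cast
    have hi : ∀ i : Fin 4, ℓ / (2 * a) ≤ ((Finset.Icc ⌈y₀ i / a⌉ ⌊(y₀ i + ℓ) / a⌋).card : ℝ) := by
      intro i
      have h := card_Icc_ge a (y₀ i) ℓ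
      have h2 : ℓ / (2 * a) ≤ ℓ / a - 1 := by
        rw [div_le_iff₀ (by positivity)]
        have : ℓ / a * (2 * a) = 2 * ℓ := by field_simp
        nlinarith [div_le_iff₀ ha |>.mp (le_refl (ℓ / a))]
      exact h2.trans h
    calc (ℓ / (2 * a)) ^ 4 = ∏ _i : Fin 4, ℓ / (2 * a) := by rw [Finset.prod_const, Finset.card_univ, Fintype.card_fin]
      _ ≤ ∏ i : Fin 4, ((Finset.Icc ⌈y₀ i / a⌉ ⌊(y₀ i + ℓ) / a⌋).card : ℝ) :=
          Finset.prod_le_prod (fun i _ => by positivity) (fun i _ => hi i)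
  -- summability (finite lattice support)
  have hfin : Set.Finite {x : Fin 4 → ℤ | f (a • siteToE (d := 4) x) ≠ 0} := by
    refine (Set.Finite.pi (fun _ : Fin 4 => Set.finite_Icc (-⌈R / a⌉) ⌈R / a⌉)).subset ?_
    intro x hx
    rw [Set.mem_univ_pi]
    intro i
    have hmem : a • siteToE (d := 4) x ∈ tsupport f := subset_tsupport _ hx
    have hball' := hfR hmem
    rw [Metric.mem_closedBall, dist_zero_right] at hball'
    have hi : ‖(a • siteToE (d := 4) x) i‖ ≤ ‖a • siteToE (d := 4) x‖ := PiLp.norm_apply_le _ i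
    have hcoord : (a • siteToE (d := 4) x) i = a * (x i : ℝ) := by simp [siteToE_apply]
    rw [hcoord, Real.norm_eq_abs, abs_mul, abs_of_pos ha] at hi
    have habs : |(x i : ℝ)| ≤ R / a := by
      rw [le_div_iff₀ ha, mul_comm]; exact hi.trans hball'
    obtain ⟨h1, h2⟩ := abs_le.mp habs
    have hceil := Int.le_ceil (R / a)
    constructor
    · have : ((-⌈R / a⌉ : ℤ) : ℝ) ≤ x i := by push_cast; linarith
      exact_mod_cast this
    · have : (x i : ℝ) ≤ ((⌈R / a⌉ : ℤ) : ℝ) := h2.trans hceil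
      exact_mod_cast this
  have hsumm : Summable fun x : Fin 4 → ℤ => f (a • siteToE (d := 4) x) :=
    summable_of_hasFiniteSupport hfin
  -- assemble
  have h1 : ∑ x ∈ B, f (a • siteToE (d := 4) x) ≤ ∑' x : Fin 4 → ℤ, f (a • siteToE (d := 4) x) :=
    hsumm.sum_le_tsum B (fun x _ => hf0 _)
  have h2 : m * (B.card : ℝ) ≤ ∑ x ∈ B, f (a • siteToE (d := 4) x) := by
    rw [mul_comm]
    have := Finset.card_nsmul_le_sum B (fun x => f (a • siteToE (d := 4) x)) m hBmem
    simpa [nsmul_eq_mul] using this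
  have ha4 : 0 < a ^ 4 := by positivity
  calc m * ℓ ^ 4 / 16 = a ^ 4 * (m * (ℓ / (2 * a)) ^ 4) := by field_simp; ring
    _ ≤ a ^ 4 * (m * (B.card : ℝ)) := by gcongr
    _ ≤ a ^ 4 * ∑' x : Fin 4 → ℤ, f (a • siteToE (d := 4) x) := by gcongr; exact h2.trans h1

end Summit.QuantumFields.YangMills.Theorems.SqueezedSkewnessLatticeSumFloor

end
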